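import Summits.MatrixMultiplication.MatrixMultiplication.Theses.NOFWindowCapacity
import Summits.MatrixMultiplication.MatrixMultiplication.Theses.WindowedCompletionRank
import Summits.MatrixMultiplication.MatrixMultiplication.Theses.DesignFlattening
import Literature.Computability.AlgebraicComplexity.GroupTheoreticMatMulProofs

/-!
# `AddTableRankLe` (stmt-MatrixMultiplication-5497) — proved

The support item `AddTableRankLe`, shared verbatim by the routes
`MatrixMultiplication/NOFWindowCapacity`, `MatrixMultiplication/WindowedCompletionRank` and
`MatrixMultiplication/DesignFlattening`: for every finite abelian group `G`, the addition table
`U_G(c; a, b) = [a + b = c]`, as a tensor in `ℂ^{G × G × G}`, has tensor rank `R(U_G) ≤ |G|`.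

## Proof

This is the character decomposition `[a + b − c = 0] = |G|⁻¹ Σ_ψ ψ(a) ψ(b) ψ(−c)` over the `|G|`
additive characters `ψ : AddChar G ℂ` (orthogonality, Mathlib `AddChar.sum_apply_eq_ite`, and
`|Ĝ| = |G|`, Mathlib `AddChar.card_eq`): a decomposition of `U_G` into `|G|` triads. The tree
already holds exactly this statement as
`Literature.Computability.AlgebraicComplexity.tensorRank_addGroupAlgTensor_le`
(`GroupTheoreticMatMulProofs.lean`, the abelian case of Cohn–Kleinberg–Szegedy–Umans 2005, §1.1 /
Thm. 5.5: `ℂ[G] ≅ ⊕ ℂ^{dᵢ×dᵢ}` with all `dᵢ = 1`); each route decl is its literal restatement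
(bound variables `c a b` for `z x y`), so the three closing theorems below are one-line
instantiations.

References: Cohn–Umans 2003 (§2, abelian groups give rank `|G|`); Cohn–Kleinberg–Szegedy–Umans
2005, §1.1 and Thm. 5.5; Alman–Blasiok 2023, §3.10; Bürgisser–Clausen–Shokrollahi 1997, §13.5.
-/

-- single-conjunct summit: `Summit.<Summit>.<Sub>` repeats `MatrixMultiplication`, which
-- `linter.dupNamespace` would flag on every declaration.
set_option linter.dupNamespace false

namespace Summit.MatrixMultiplication.MatrixMultiplication.Theorems

/-- Settles `stmt-MatrixMultiplication-5497` (`AddTableRankLe`) for route `NOFWindowCapacity`: the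
addition table `[a + b = c]` of a finite abelian group `G` has tensor rank at most `|G|` over `ℂ`
(character decomposition; `Literature.Computability.AlgebraicComplexity.tensorRank_addGroupAlgTensor_le`).
[cite: CohnKleinbergSzegedyUmans2005, §1.1 and Thm. 5.5] -/
theorem addTableRankLe_proof :
    Summit.MatrixMultiplication.MatrixMultiplication.Theses.NOFWindowCapacity.AddTableRankLe := by
  unfold Summit.MatrixMultiplication.MatrixMultiplication.Theses.NOFWindowCapacity.AddTableRankLe
  intro G _ _ _
  exact Literature.Computability.AlgebraicComplexity.tensorRank_addGroupAlgTensor_le G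

/-- The same item `stmt-MatrixMultiplication-5497` (`AddTableRankLe`) as stated in route
`WindowedCompletionRank` (verbatim the same proposition): `R([a + b = c]) ≤ |G|` for every finite
abelian group `G`. [cite: CohnKleinbergSzegedyUmans2005, §1.1 and Thm. 5.5] -/
theorem windowedCompletionRank_addTableRankLe_proof :
    Summit.MatrixMultiplication.MatrixMultiplication.Theses.WindowedCompletionRank.AddTableRankLe := by
  unfold Summit.MatrixMultiplication.MatrixMultiplication.Theses.WindowedCompletionRank.AddTableRankLe
  intro G _ _ _
  exact Literature.Computability.AlgebraicComplexity.tensorRank_addGroupAlgTensor_le G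

/-- The same item `stmt-MatrixMultiplication-5497` (`AddTableRankLe`) as stated in route
`DesignFlattening` (verbatim the same proposition): `R([a + b = c]) ≤ |G|` for every finite
abelian group `G`. [cite: CohnKleinbergSzegedyUmans2005, §1.1 and Thm. 5.5] -/
theorem designFlattening_addTableRankLe_proof :
    Summit.MatrixMultiplication.MatrixMultiplication.Theses.DesignFlattening.AddTableRankLe := by
  unfold Summit.MatrixMultiplication.MatrixMultiplication.Theses.DesignFlattening.AddTableRankLe
  intro G _ _ _
  exact Literature.Computability.AlgebraicComplexity.tensorRank_addGroupAlgTensor_le G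

end Summit.MatrixMultiplication.MatrixMultiplication.Theorems
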